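import Summits.Ventures.Crystal3D.Theorems.StickyWulffConstantNoReconstructionGainPredSlotBudgetRaisedCore
import HarnessLib

/-!
# The pred-slot budget with a raised up bond, at most two contacts: the frame-level statement

HONEST FRAMING. Part of the venture `Summits/Ventures/Crystal3D` (cell `crystal3d-full`), helper
`--supports` the crux `NoReconstructionGain` (stmt-Ventures-19144, route
`route-Ventures-StickyWulffConstant`), line `adhesion` (wulff-p1 g14).  THIS FILE CLOSES THE BRICK
`predSlotBudget_of_upBond_raised_le_two` (B1b₂) OF SKELETON v21 BY NAME: the pred-slot budget of g13
(`stub_predSlotBudget70`) when one up bond `A·pos_ε(1, −o)` of the grain is `ν`-raised (the band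
`54.7°–70.5°` beyond the basal cone) and the ball has AT MOST TWO substrate contacts.  With the landed
B1a (`…PredSlotBudgetCone`, up-triple `ν`-below) this leaves exactly one brick of the g13 budget open:
B1b₃ (raised bond, three contacts).

Method: the rotation by `120°` about the axis (`rot120_bonds`, product of the bond mirrors of `h₁` and
`h₂`) and the half-turn of `…PredSlotBudgetPairs` move the raised bond to `w₃ = pos(1,0,−1)` and the
letter to `+1`; in the cubic coordinates of `…GrainFrameBudgetThree` the raised frame is "region R"
(`b ≤ a`; mirror-normalised `a + b ≥ 0` by relabelling the coordinates) and the budget is the coordinate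
theorem `raisedBudget_one` / `raisedBudget_two` (`…PredSlotBudgetRaisedZones`) with the six credit
propositions of the registered statement, fed slot by slot (`predSlotBudget_coreR_le_two`).

WHAT THIS IS NOT: three contacts with a raised bond (B1b₃, census-certified, lead memo RAISED-g14.md);
the crux on cores; rung F-C1 not moved.
-/

noncomputable section

namespace Summit.Ventures.Crystal3D.Theorems

open Summit.Ventures.Crystal3D Finset
open Literature.MathematicalPhysics.StatisticalMechanics (fccStacking barlowPos constHagg barlowPos_mem
  threeOffsets barlowPos_apply_zero barlowPos_apply_one barlowPos_apply_two haggLabel_const)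
open Literature.Algebra.EuclideanLattices (inner_fin_three norm_sq_fin_three)
open scoped InnerProductSpace

/-! ### The raised bond in the other two positions -/

/-- **CORE, raised `w₁`** — from the raised-`w₃` core in the frame `A ∘ g` (`rot120_bonds`). -/
theorem predSlotBudget_coreR_le_two_w1 (A : EuclideanSpace ℝ (Fin 3) ≃ₗᵢ[ℝ] EuclideanSpace ℝ (Fin 3))
    (ν : EuclideanSpace ℝ (Fin 3)) (hν : ‖ν‖ = 1)
    (haxis : ⟪ν, A (EuclideanSpace.single (2 : Fin 3) (1 : ℝ))⟫_ℝ ≤ -(1 / 3)) (t : ℝ)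
    (K : Finset (EuclideanSpace ℝ (Fin 3))) (hK : K.card ≤ 2)
    (hK1 : ∀ u ∈ K, ‖u‖ = 1 ∧ ⟪u, ν⟫_ℝ ≤ -t) (hK2 : ∀ u ∈ K, ∀ u' ∈ K, u ≠ u' → ⟪u, u'⟫_ℝ ≤ 1 / 2)
    (g₁ g₂ g₃ : EuclideanSpace ℝ (Fin 3))
    (hg₁ : g₁ = A (barlowPos 1 (Real.sqrt (2 / 3)) constHagg 0 1 0) ∨ g₁ = -A (barlowPos 1 (Real.sqrt (2 / 3)) constHagg 0 1 0))
    (hg₂ : g₂ = A (barlowPos 1 (Real.sqrt (2 / 3)) constHagg 0 0 1) ∨ g₂ = -A (barlowPos 1 (Real.sqrt (2 / 3)) constHagg 0 0 1))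
    (hg₃ : g₃ = A (barlowPos 1 (Real.sqrt (2 / 3)) constHagg 0 1 (-1)) ∨ g₃ = -A (barlowPos 1 (Real.sqrt (2 / 3)) constHagg 0 1 (-1)))
    (hraised : 0 ≤ ⟪A (barlowPos 1 (Real.sqrt (2 / 3)) constHagg 1 0 0), ν⟫_ℝ) :
    (K.card : ℝ) ≤
      (if (∃ u ∈ K, 1 / 2 < ⟪u, if ⟪g₁, ν⟫_ℝ < 0 then g₁ else -g₁⟫_ℝ) ∨
          ⟪(if ⟪g₁, ν⟫_ℝ < 0 then g₁ else -g₁), ν⟫_ℝ ≤ -t then (1 : ℝ) else 0) +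
      (if (∃ u ∈ K, 1 / 2 < ⟪u, if ⟪g₂, ν⟫_ℝ < 0 then g₂ else -g₂⟫_ℝ) ∨
          ⟪(if ⟪g₂, ν⟫_ℝ < 0 then g₂ else -g₂), ν⟫_ℝ ≤ -t then (1 : ℝ) else 0) +
      (if (∃ u ∈ K, 1 / 2 < ⟪u, if ⟪g₃, ν⟫_ℝ < 0 then g₃ else -g₃⟫_ℝ) ∨
          ⟪(if ⟪g₃, ν⟫_ℝ < 0 then g₃ else -g₃), ν⟫_ℝ ≤ -t then (1 : ℝ) else 0) +
      (if (∃ u ∈ K, 1 / 2 < ⟪u, A (barlowPos 1 (Real.sqrt (2 / 3)) constHagg 1 0 0)⟫_ℝ) ∨ ⟪A (barlowPos 1 (Real.sqrt (2 / 3)) constHagg 1 0 0), ν⟫_ℝ ≤ -t then (1 : ℝ) else 0) +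
      (if (∃ u ∈ K, 1 / 2 < ⟪u, A (barlowPos 1 (Real.sqrt (2 / 3)) constHagg 1 (-1) 0)⟫_ℝ) ∨ ⟪A (barlowPos 1 (Real.sqrt (2 / 3)) constHagg 1 (-1) 0), ν⟫_ℝ ≤ -t then (1 : ℝ) else 0) +
      (if (∃ u ∈ K, 1 / 2 < ⟪u, A (barlowPos 1 (Real.sqrt (2 / 3)) constHagg 1 0 (-1))⟫_ℝ) ∨ ⟪A (barlowPos 1 (Real.sqrt (2 / 3)) constHagg 1 0 (-1)), ν⟫_ℝ ≤ -t then (1 : ℝ) else 0) := by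
  obtain ⟨r₁, r₂, r₃, q₁, q₂, q₃, re⟩ := rot120_bonds
  set g := (((ℝ ∙ (barlowPos 1 (Real.sqrt (2 / 3)) constHagg 0 1 0))ᗮ.reflection).trans ((ℝ ∙ (barlowPos 1 (Real.sqrt (2 / 3)) constHagg 0 0 1))ᗮ.reflection)) with hg
  have e1 : (g.trans A) (barlowPos 1 (Real.sqrt (2 / 3)) constHagg 0 1 0) = -A (barlowPos 1 (Real.sqrt (2 / 3)) constHagg 0 1 (-1)) := by
    rw [LinearIsometryEquiv.trans_apply, q₁, map_neg]
  have e2 : (g.trans A) (barlowPos 1 (Real.sqrt (2 / 3)) constHagg 0 0 1) = -A (barlowPos 1 (Real.sqrt (2 / 3)) constHagg 0 1 0) := by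
    rw [LinearIsometryEquiv.trans_apply, q₂, map_neg]
  have e3 : (g.trans A) (barlowPos 1 (Real.sqrt (2 / 3)) constHagg 0 1 (-1)) = A (barlowPos 1 (Real.sqrt (2 / 3)) constHagg 0 0 1) := by
    rw [LinearIsometryEquiv.trans_apply, q₃]
  have hc := predSlotBudget_coreR_le_two (g.trans A) ν hν
    (by rw [LinearIsometryEquiv.trans_apply, re]; exact haxis) t K hK hK1 hK2 g₃ g₁ g₂
    (hg₃.symm.imp (fun h => by rw [h, e1]) (fun h => by rw [h, e1, neg_neg]))
    (hg₁.symm.imp (fun h => by rw [h, e2]) (fun h => by rw [h, e2, neg_neg]))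
    (hg₂.imp (fun h => by rw [h, e3]) (fun h => by rw [h, e3]))
    (by rw [LinearIsometryEquiv.trans_apply, r₃]; exact hraised)
  simp only [LinearIsometryEquiv.trans_apply, r₁, r₂, r₃] at hc
  linarith only [hc]

/-- **CORE, raised `w₂`** — from the raised-`w₃` core in the frame `A ∘ g ∘ g`. -/
theorem predSlotBudget_coreR_le_two_w2 (A : EuclideanSpace ℝ (Fin 3) ≃ₗᵢ[ℝ] EuclideanSpace ℝ (Fin 3))
    (ν : EuclideanSpace ℝ (Fin 3)) (hν : ‖ν‖ = 1)
    (haxis : ⟪ν, A (EuclideanSpace.single (2 : Fin 3) (1 : ℝ))⟫_ℝ ≤ -(1 / 3)) (t : ℝ)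
    (K : Finset (EuclideanSpace ℝ (Fin 3))) (hK : K.card ≤ 2)
    (hK1 : ∀ u ∈ K, ‖u‖ = 1 ∧ ⟪u, ν⟫_ℝ ≤ -t) (hK2 : ∀ u ∈ K, ∀ u' ∈ K, u ≠ u' → ⟪u, u'⟫_ℝ ≤ 1 / 2)
    (g₁ g₂ g₃ : EuclideanSpace ℝ (Fin 3))
    (hg₁ : g₁ = A (barlowPos 1 (Real.sqrt (2 / 3)) constHagg 0 1 0) ∨ g₁ = -A (barlowPos 1 (Real.sqrt (2 / 3)) constHagg 0 1 0))
    (hg₂ : g₂ = A (barlowPos 1 (Real.sqrt (2 / 3)) constHagg 0 0 1) ∨ g₂ = -A (barlowPos 1 (Real.sqrt (2 / 3)) constHagg 0 0 1))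
    (hg₃ : g₃ = A (barlowPos 1 (Real.sqrt (2 / 3)) constHagg 0 1 (-1)) ∨ g₃ = -A (barlowPos 1 (Real.sqrt (2 / 3)) constHagg 0 1 (-1)))
    (hraised : 0 ≤ ⟪A (barlowPos 1 (Real.sqrt (2 / 3)) constHagg 1 (-1) 0), ν⟫_ℝ) :
    (K.card : ℝ) ≤
      (if (∃ u ∈ K, 1 / 2 < ⟪u, if ⟪g₁, ν⟫_ℝ < 0 then g₁ else -g₁⟫_ℝ) ∨
          ⟪(if ⟪g₁, ν⟫_ℝ < 0 then g₁ else -g₁), ν⟫_ℝ ≤ -t then (1 : ℝ) else 0) +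
      (if (∃ u ∈ K, 1 / 2 < ⟪u, if ⟪g₂, ν⟫_ℝ < 0 then g₂ else -g₂⟫_ℝ) ∨
          ⟪(if ⟪g₂, ν⟫_ℝ < 0 then g₂ else -g₂), ν⟫_ℝ ≤ -t then (1 : ℝ) else 0) +
      (if (∃ u ∈ K, 1 / 2 < ⟪u, if ⟪g₃, ν⟫_ℝ < 0 then g₃ else -g₃⟫_ℝ) ∨
          ⟪(if ⟪g₃, ν⟫_ℝ < 0 then g₃ else -g₃), ν⟫_ℝ ≤ -t then (1 : ℝ) else 0) +
      (if (∃ u ∈ K, 1 / 2 < ⟪u, A (barlowPos 1 (Real.sqrt (2 / 3)) constHagg 1 0 0)⟫_ℝ) ∨ ⟪A (barlowPos 1 (Real.sqrt (2 / 3)) constHagg 1 0 0), ν⟫_ℝ ≤ -t then (1 : ℝ) else 0) +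
      (if (∃ u ∈ K, 1 / 2 < ⟪u, A (barlowPos 1 (Real.sqrt (2 / 3)) constHagg 1 (-1) 0)⟫_ℝ) ∨ ⟪A (barlowPos 1 (Real.sqrt (2 / 3)) constHagg 1 (-1) 0), ν⟫_ℝ ≤ -t then (1 : ℝ) else 0) +
      (if (∃ u ∈ K, 1 / 2 < ⟪u, A (barlowPos 1 (Real.sqrt (2 / 3)) constHagg 1 0 (-1))⟫_ℝ) ∨ ⟪A (barlowPos 1 (Real.sqrt (2 / 3)) constHagg 1 0 (-1)), ν⟫_ℝ ≤ -t then (1 : ℝ) else 0) := by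
  obtain ⟨r₁, r₂, r₃, q₁, q₂, q₃, re⟩ := rot120_bonds
  set g := (((ℝ ∙ (barlowPos 1 (Real.sqrt (2 / 3)) constHagg 0 1 0))ᗮ.reflection).trans ((ℝ ∙ (barlowPos 1 (Real.sqrt (2 / 3)) constHagg 0 0 1))ᗮ.reflection)) with hg
  have e1 : ((g.trans g).trans A) (barlowPos 1 (Real.sqrt (2 / 3)) constHagg 0 1 0) = -A (barlowPos 1 (Real.sqrt (2 / 3)) constHagg 0 0 1) := by
    rw [LinearIsometryEquiv.trans_apply, LinearIsometryEquiv.trans_apply, q₁, map_neg, q₃, map_neg]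
  have e2 : ((g.trans g).trans A) (barlowPos 1 (Real.sqrt (2 / 3)) constHagg 0 0 1) = A (barlowPos 1 (Real.sqrt (2 / 3)) constHagg 0 1 (-1)) := by
    rw [LinearIsometryEquiv.trans_apply, LinearIsometryEquiv.trans_apply, q₂, map_neg, q₁, neg_neg]
  have e3 : ((g.trans g).trans A) (barlowPos 1 (Real.sqrt (2 / 3)) constHagg 0 1 (-1)) = -A (barlowPos 1 (Real.sqrt (2 / 3)) constHagg 0 1 0) := by
    rw [LinearIsometryEquiv.trans_apply, LinearIsometryEquiv.trans_apply, q₃, q₂, map_neg]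
  have hc := predSlotBudget_coreR_le_two ((g.trans g).trans A) ν hν
    (by rw [LinearIsometryEquiv.trans_apply, LinearIsometryEquiv.trans_apply, re, re]; exact haxis) t K hK hK1 hK2
    g₂ g₃ g₁
    (hg₂.symm.imp (fun h => by rw [h, e1]) (fun h => by rw [h, e1, neg_neg]))
    (hg₃.imp (fun h => by rw [h, e2]) (fun h => by rw [h, e2]))
    (hg₁.symm.imp (fun h => by rw [h, e3]) (fun h => by rw [h, e3, neg_neg]))
    (by rw [LinearIsometryEquiv.trans_apply, LinearIsometryEquiv.trans_apply, r₃, r₁]; exact hraised)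
  simp only [LinearIsometryEquiv.trans_apply, r₁, r₂, r₃] at hc
  linarith only [hc]

/-! ### The registered brick B1b₂ -/

/-- **THE PRED-SLOT BUDGET WITH A RAISED UP BOND, AT MOST TWO CONTACTS** (the registered brick
`predSlotBudget_of_upBond_raised_le_two` of skeleton v21, by name): letter `+1` in the frame `A`, letter
`−1` in the half-turn frame `A ∘ R_π` (`halfTurn_bonds`); the raised bond is rotated to `w₃`
(`predSlotBudget_coreR_le_two`, `…_w1`, `…_w2`). -/
theorem predSlotBudget_of_upBond_raised_le_two :
    ∀ A : EuclideanSpace ℝ (Fin 3) ≃ₗᵢ[ℝ] EuclideanSpace ℝ (Fin 3), ∀ ν : EuclideanSpace ℝ (Fin 3), ‖ν‖ = 1 →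
      ⟪ν, A (EuclideanSpace.single (2 : Fin 3) (1 : ℝ))⟫_ℝ ≤ -(1 / 3) →
      ∀ t : ℝ, 0 < t → ∀ K : Finset (EuclideanSpace ℝ (Fin 3)), K.card ≤ 3 →
        (∀ u ∈ K, ‖u‖ = 1 ∧ ⟪u, ν⟫_ℝ ≤ -t) →
        (∀ u ∈ K, ∀ u' ∈ K, u ≠ u' →
          ⟪u, u'⟫_ℝ = 1 / 2 ∨ ⟪u, u'⟫_ℝ = 0 ∨ ⟪u, u'⟫_ℝ = -1 / 2) →
        ∀ ε : ℤ, (ε = 1 ∨ ε = -1) →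
        (∃ o ∈ threeOffsets (-ε),
          0 ≤ ⟪A (barlowPos 1 (Real.sqrt (2 / 3)) (fun _ : ℤ => ε) 1 (-o.1) (-o.2)), ν⟫_ℝ) →
        K.card ≤ 2 →
        (K.card : ℝ) ≤
          (if (∃ u ∈ K, 1 / 2 < ⟪u, if ⟪A (barlowPos 1 (Real.sqrt (2 / 3)) constHagg 0 1 0), ν⟫_ℝ < 0
                then A (barlowPos 1 (Real.sqrt (2 / 3)) constHagg 0 1 0)
                else -A (barlowPos 1 (Real.sqrt (2 / 3)) constHagg 0 1 0)⟫_ℝ) ∨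
              ⟪(if ⟪A (barlowPos 1 (Real.sqrt (2 / 3)) constHagg 0 1 0), ν⟫_ℝ < 0
                then A (barlowPos 1 (Real.sqrt (2 / 3)) constHagg 0 1 0)
                else -A (barlowPos 1 (Real.sqrt (2 / 3)) constHagg 0 1 0)), ν⟫_ℝ ≤ -t
            then (1 : ℝ) else 0) +
          (if (∃ u ∈ K, 1 / 2 < ⟪u, if ⟪A (barlowPos 1 (Real.sqrt (2 / 3)) constHagg 0 0 1), ν⟫_ℝ < 0
                then A (barlowPos 1 (Real.sqrt (2 / 3)) constHagg 0 0 1)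
                else -A (barlowPos 1 (Real.sqrt (2 / 3)) constHagg 0 0 1)⟫_ℝ) ∨
              ⟪(if ⟪A (barlowPos 1 (Real.sqrt (2 / 3)) constHagg 0 0 1), ν⟫_ℝ < 0
                then A (barlowPos 1 (Real.sqrt (2 / 3)) constHagg 0 0 1)
                else -A (barlowPos 1 (Real.sqrt (2 / 3)) constHagg 0 0 1)), ν⟫_ℝ ≤ -t
            then (1 : ℝ) else 0) +
          (if (∃ u ∈ K, 1 / 2 < ⟪u, if ⟪A (barlowPos 1 (Real.sqrt (2 / 3)) constHagg 0 1 (-1)), ν⟫_ℝ < 0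
                then A (barlowPos 1 (Real.sqrt (2 / 3)) constHagg 0 1 (-1))
                else -A (barlowPos 1 (Real.sqrt (2 / 3)) constHagg 0 1 (-1))⟫_ℝ) ∨
              ⟪(if ⟪A (barlowPos 1 (Real.sqrt (2 / 3)) constHagg 0 1 (-1)), ν⟫_ℝ < 0
                then A (barlowPos 1 (Real.sqrt (2 / 3)) constHagg 0 1 (-1))
                else -A (barlowPos 1 (Real.sqrt (2 / 3)) constHagg 0 1 (-1))), ν⟫_ℝ ≤ -t
            then (1 : ℝ) else 0) +
          (((threeOffsets (-ε)).filter fun o =>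
            (∃ u ∈ K, 1 / 2 < ⟪u, A (barlowPos 1 (Real.sqrt (2 / 3)) (fun _ : ℤ => ε) 1 (-o.1) (-o.2))⟫_ℝ) ∨
              ⟪A (barlowPos 1 (Real.sqrt (2 / 3)) (fun _ : ℤ => ε) 1 (-o.1) (-o.2)), ν⟫_ℝ ≤ -t).card : ℝ) := by
  intro A ν hν haxis t ht K hK hK1 hK2 ε hε hraised hK2c
  have hK2' : ∀ u ∈ K, ∀ u' ∈ K, u ≠ u' → ⟪u, u'⟫_ℝ ≤ 1 / 2 := by
    intro u hu u' hu' hne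
    rcases hK2 u hu u' hu' hne with h | h | h <;> rw [h] <;> norm_num
  rcases hε with rfl | rfl
  · -- letter `+1`: the frame `A` itself
    have hT : threeOffsets (-1) = {(0, 0), (1, 0), (0, 1)} := by simp [threeOffsets]
    have hc1 : (fun _ : ℤ => (1 : ℤ)) = constHagg := rfl
    rw [hT, card_filter, sum_insert (by decide), sum_insert (by decide), sum_singleton]
    push_cast
    simp only [neg_zero, hc1]
    rw [hT] at hraised
    simp only [mem_insert, mem_singleton] at hraised
    obtain ⟨o, ho, hge⟩ := hraised
    rcases ho with rfl | rfl | rfl <;> simp only [neg_zero, hc1] at hge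
    · have hc := predSlotBudget_coreR_le_two_w1 A ν hν haxis t K hK2c hK1 hK2' _ _ _ (Or.inl rfl)
        (Or.inl rfl) (Or.inl rfl) hge
      linarith only [hc]
    · have hc := predSlotBudget_coreR_le_two_w2 A ν hν haxis t K hK2c hK1 hK2' _ _ _ (Or.inl rfl)
        (Or.inl rfl) (Or.inl rfl) hge
      linarith only [hc]
    · have hc := predSlotBudget_coreR_le_two A ν hν haxis t K hK2c hK1 hK2' _ _ _ (Or.inl rfl)
        (Or.inl rfl) (Or.inl rfl) hge
      linarith only [hc]
  · -- letter `−1`: the half-turn frame `A ∘ R_π`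
    have hT : threeOffsets (-(-1 : ℤ)) = {(0, 0), (-1, 0), (0, -1)} := by simp [threeOffsets]
    rw [hT, card_filter, sum_insert (by decide), sum_insert (by decide), sum_singleton]
    push_cast
    simp only [neg_zero]
    rw [hT] at hraised
    simp only [mem_insert, mem_singleton] at hraised
    obtain ⟨r₁, r₂, r₃, s₁, s₂, s₃, re⟩ := halfTurn_bonds
    set R := (((ℝ ∙ (EuclideanSpace.single (2 : Fin 3) (1 : ℝ)))ᗮ.reflection).trans (LinearIsometryEquiv.neg ℝ)) with hR
    have haxis' : ⟪ν, (R.trans A) (EuclideanSpace.single (2 : Fin 3) (1 : ℝ))⟫_ℝ ≤ -(1 / 3) := by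
      rw [LinearIsometryEquiv.trans_apply, re]; exact haxis
    have k₁ : A (barlowPos 1 (Real.sqrt (2 / 3)) constHagg 0 1 0) = -(R.trans A) (barlowPos 1 (Real.sqrt (2 / 3)) constHagg 0 1 0) := by
      rw [LinearIsometryEquiv.trans_apply, r₁, map_neg, neg_neg]
    have k₂ : A (barlowPos 1 (Real.sqrt (2 / 3)) constHagg 0 0 1) = -(R.trans A) (barlowPos 1 (Real.sqrt (2 / 3)) constHagg 0 0 1) := by
      rw [LinearIsometryEquiv.trans_apply, r₂, map_neg, neg_neg]
    have k₃ : A (barlowPos 1 (Real.sqrt (2 / 3)) constHagg 0 1 (-1)) = -(R.trans A) (barlowPos 1 (Real.sqrt (2 / 3)) constHagg 0 1 (-1)) := by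
      rw [LinearIsometryEquiv.trans_apply, r₃, map_neg, neg_neg]
    have t₁ : (R.trans A) (barlowPos 1 (Real.sqrt (2 / 3)) constHagg 1 0 0) = A (barlowPos 1 (Real.sqrt (2 / 3)) (fun _ : ℤ => (-1 : ℤ)) 1 0 0) := by
      rw [LinearIsometryEquiv.trans_apply, s₁]
    have t₂ : (R.trans A) (barlowPos 1 (Real.sqrt (2 / 3)) constHagg 1 (-1) 0) = A (barlowPos 1 (Real.sqrt (2 / 3)) (fun _ : ℤ => (-1 : ℤ)) 1 1 0) := by
      rw [LinearIsometryEquiv.trans_apply, s₂]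
    have t₃ : (R.trans A) (barlowPos 1 (Real.sqrt (2 / 3)) constHagg 1 0 (-1)) = A (barlowPos 1 (Real.sqrt (2 / 3)) (fun _ : ℤ => (-1 : ℤ)) 1 0 1) := by
      rw [LinearIsometryEquiv.trans_apply, s₃]
    obtain ⟨o, ho, hge⟩ := hraised
    rcases ho with rfl | rfl | rfl <;> simp only [neg_zero, neg_neg] at hge
    · have hc := predSlotBudget_coreR_le_two_w1 (R.trans A) ν hν haxis' t K hK2c hK1 hK2' _ _ _ (Or.inr k₁)
        (Or.inr k₂) (Or.inr k₃) (by rw [t₁]; exact hge)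
      rw [t₁, t₂, t₃] at hc
      linarith only [hc]
    · have hc := predSlotBudget_coreR_le_two_w2 (R.trans A) ν hν haxis' t K hK2c hK1 hK2' _ _ _ (Or.inr k₁)
        (Or.inr k₂) (Or.inr k₃) (by rw [t₂]; exact hge)
      rw [t₁, t₂, t₃] at hc
      linarith only [hc]
    · have hc := predSlotBudget_coreR_le_two (R.trans A) ν hν haxis' t K hK2c hK1 hK2' _ _ _ (Or.inr k₁)
        (Or.inr k₂) (Or.inr k₃) (by rw [t₃]; exact hge)
      rw [t₁, t₂, t₃] at hc
      linarith only [hc]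

end Summit.Ventures.Crystal3D.Theorems

end
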